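import Summits.ResolutionOfSingularities.ResolutionOfSingularities.Theorems.FrobeniusLadderFInjectiveMacaulayficationNonFullLoopFloorOneLocus
import Summits.ResolutionOfSingularities.ResolutionOfSingularities.Theorems.FrobeniusLadderFInjectiveMacaulayficationNonFullLoopFloorThreeLocus
import Summits.ResolutionOfSingularities.ResolutionOfSingularities.Theorems.FrobeniusLadderFInjectiveMacaulayficationNonFullLoopFloorFive
import Summits.ResolutionOfSingularities.ResolutionOfSingularities.Theorems.FrobeniusLadderFInjectiveMacaulayficationSingTowerNesting
import Summits.ResolutionOfSingularities.ResolutionOfSingularities.Theorems.FrobeniusLadderFInjectiveMacaulayficationIntrinsicTowerInstanceP2d4C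
import Summits.ResolutionOfSingularities.ResolutionOfSingularities.Theorems.FrobeniusLadderFInjectiveMacaulayficationTowerPersistenceKit
import Literature.AlgebraicGeometry.Resolution.AffineBlowupUnique
import Literature.AlgebraicGeometry.Resolution.BlowupsFlatBaseChange
import Literature.AlgebraicGeometry.Resolution.AffineBlowupCartier
import HarnessLib

/-!
# NEG-N: the N-centre of an affine floor FROM ITS TWO-SIDED LOCUS LEMMA (generic), and the per-floor LINKS «every blowing up of `U_k` along its N-centre
# receives `U_{k+1}` as an open» for floors 1, 3, 5
# (crux `FInjectiveMacaulayfication` stmt-ResolutionOfSingularities-15315, chain w45a; res-L1-w45a-plan-1 RULINGS R19.21 «NEG-N» / R19.22 (floors 1, 3, 5 → stub-1) / R19.23 / R20.1;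
# generic part = res-L1-w45a-lead-1's (L-g) ✓ p645060 `NonFullLoopFrame` §4 made generic; link shape = the `hrec` binder of ✓ p635381
# `TowerPersistenceKit.not_exists_tower_of_recurrent_family`; seat res-L1-w45a-stub-1 g12)

[OURS · L1 W4.5a] Support file (`--supports stmt-ResolutionOfSingularities-15315 --as helper`); replaces the role of NO printed item; NOT a statement of any
manuscript; def-free; UNCONDITIONAL. AI-written (AI review is weaker than expert review).

* §1 GENERIC (`k` a field of characteristic `p`, `A` a `k`-algebra, `P ⊂ A` prime, `hlocus : ∀ w : Spec A, ¬ FullCl p 𝒪_w ↔ P ≤ w`):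
  `nonFullLocus_eq_support_of_locus` (the non-FULL locus is `V(P)`), `nonFullLocus_inter_compl_regularLocus` (regular ⇒ FULL, p640607 — the `∩ Singᶜ… ` of the recipe is
  harmless), ★ `nonFullCentre_eq_of_locus : Recipes.nonFullCentre p (Spec A) = P~`, `intrinsicCentre_eq_of_locus` (the v1 centre), ★★ `exists_isOpenImmersion_of_isBlowup_nonFullCentre`:
  ONE open immersion `V ⟶ Bl_P (Spec A)` makes EVERY blowing up of `Spec A` along its N-centre receive an open immersion from `V` (`IsBlowup.unique`) — the per-floor `hrec`
  datum of the recurrent-family lemma / the link of a bad prefix; `exists_not_fullCl_of_isOpenImmersion` (`hbad` goes up along open immersions); ★★★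
  `exists_isOpenImmersion_of_isBlowup_of_isOpenImmersion` — THE GLOBAL STEP: `Spec A` open in a floor `F` ⇒ every blowing up of `F` along ITS N-centre receives `V`
  (`nonFullCentreLiteral_local` + Literature `IsBlowup.pullback_snd_of_flat` + the link) = the inductive step of lead-1's NEG-A socket `hocc`.
* §2 FLOOR 1 (`U₁ = Spec k[X]/(g₁)`, centre `𝔪`; ✓ p643973 / ✓ p646599): `NonFullLoopFloorOne.nonFullCentre_eq`, ★★ `NonFullLoopFloorOne.exists_isOpenImmersion_of_isBlowup` (every
  N-blow-up of `U₁` receives `U₂`), `NonFullLoopFloorOne.exists_not_fullCl` (`hbad`), ★★★ `NonFullLoopFloorOne.exists_isOpenImmersion_step` (U₁ ⊆° F ⇒ U₂ ⊆° every N-blow-up of F).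
* §3 FLOOR 3 (`U₃ = Spec k[X]/(g₃)`; ✓ p644128 / ✓ p647439): the same four (every N-blow-up of `U₃`, or of a floor containing `U₃`, receives `U₄`).
* §4 FLOOR 5 (`U₀ = Spec k[X]/(g₅)`, centre `(x̄,ȳ,z̄)`; ✓ p645060 §3 + ✓ p647546 §4): ★★ `NonFullLoopFloorFive.exists_isOpenImmersion_of_isBlowup` — EVERY blowing up of
  the period-one germ along its N-centre receives `U₀` ITSELF as an open (the loop, `hrec` with `next 5 = 5`), `NonFullLoopFloorFive.exists_not_fullCl`, ★★★
  `NonFullLoopFloorFive.exists_isOpenImmersion_step` (U₀ ⊆° F ⇒ U₀ ⊆° every N-blow-up of F: the loop closes inside ANY global tower).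
NOT here: floors 0, 2, 4 (res-L1-w45a-stub-3; §1 applies verbatim), the local→global transfer NEG-T (✓ p646420/p647370), the assembly NEG-A. [folklore assembly; cite:
GortzWedhorn2020, Prop. 13.91 (2) and (13.19); StacksProject, Tag 0804]
-/

-- single-problem summit: the doubled namespace component is forced
set_option linter.dupNamespace false

noncomputable section

open AlgebraicGeometry CategoryTheory CategoryTheory.Limits Literature.AlgebraicGeometry.Resolution TopologicalSpace IsLocalRing MvPolynomial

namespace Summit.ResolutionOfSingularities.ResolutionOfSingularities.Theorems.FInjectiveMacaulayfication

open SliceableCentre IntrinsicTower IntrinsicTower.Recipes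

/-! ## §1 Generic: the N-centre of `Spec A` from a two-sided locus lemma -/

namespace NonFullCentreOfLocus

/-- The non-FULL locus of `Spec A` is the support `V(P)` of `P~` (restatement of the locus lemma). [OURS · generic] -/
theorem nonFullLocus_eq_support_of_locus (p : ℕ) {A : Type} [CommRing A] (P : Ideal A)
    (hlocus : ∀ w : Spec (.of A), ¬ FullCl p ((Spec (.of A)).presheaf.stalk w) ↔ P ≤ w.asIdeal) :
    nonFullLocus p (Spec (.of A)) = ((affineBlowup.idealSheaf P).support : Set (Spec (.of A))) := by
  rw [affineBlowup.support_idealSheaf]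
  ext w
  exact hlocus w

/-- Non-FULL points are singular (regular ⇒ FULL, p640607), so intersecting the non-FULL locus with the singular locus changes nothing — for ANY scheme over a field of
characteristic `p`. [OURS · generic] -/
theorem nonFullLocus_inter_compl_regularLocus (p : ℕ) [Fact p.Prime] (k : Type) [Field k] [CharP k p] {S : Scheme.{0}} (f : S ⟶ Spec (.of k)) :
    nonFullLocus p S ∩ (Scheme.regularLocus S)ᶜ = nonFullLocus p S :=
  Set.inter_eq_left.mpr fun s hs hreg => hs (RegTower.fullCl_stalk_of_mem_regularLocus p f s hreg)

/-- ★ **THE N-CENTRE FROM THE LOCUS LEMMA**: if the non-FULL points of `Spec A` (`A` an algebra over a field `k` of characteristic `p`) are exactly those of `V(P)`, `P` prime,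
then `Recipes.nonFullCentre p (Spec A) = P~` (the reduced ideal sheaf of the closure of a closed set with prime ideal is that ideal). [OURS · generic; lead-1's (L-g) §4
verbatim with `A`, `P` abstract] -/
theorem nonFullCentre_eq_of_locus (p : ℕ) [Fact p.Prime] (k : Type) [Field k] [CharP k p] {A : Type} [CommRing A] [Algebra k A] (P : Ideal A) [P.IsPrime]
    (hlocus : ∀ w : Spec (.of A), ¬ FullCl p ((Spec (.of A)).presheaf.stalk w) ↔ P ≤ w.asIdeal) :
    nonFullCentre p (Spec (.of A)) = affineBlowup.idealSheaf P := by
  have hcl : (⟨closure (nonFullLocus p (Spec (.of A)) ∩ (Scheme.regularLocus (Spec (.of A)))ᶜ), isClosed_closure⟩ : Closeds (Spec (.of A))) =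
      (affineBlowup.idealSheaf P).support := by
    apply Closeds.ext
    change closure _ = _
    rw [nonFullLocus_inter_compl_regularLocus p k (Spec.map (CommRingCat.ofHom (algebraMap k A))), nonFullLocus_eq_support_of_locus p P hlocus]
    exact (Scheme.IdealSheafData.support _).isClosed.closure_eq
  change Scheme.IdealSheafData.vanishingIdeal _ = _
  rw [hcl, Scheme.IdealSheafData.vanishingIdeal_support, IntrinsicTower.InstanceTauFloorP2d4C.radical_idealSheaf_of_isPrime]

/-- The v1 intrinsic centre agrees: `IntrinsicTower.centre p (Spec A) = P~` under the locus lemma (any commutative ring `A`). [OURS · generic] -/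
theorem intrinsicCentre_eq_of_locus (p : ℕ) {A : Type} [CommRing A] (P : Ideal A) [P.IsPrime]
    (hlocus : ∀ w : Spec (.of A), ¬ FullCl p ((Spec (.of A)).presheaf.stalk w) ↔ P ≤ w.asIdeal) :
    IntrinsicTower.centre p (Spec (.of A)) = affineBlowup.idealSheaf P := by
  have hcl : (⟨closure (nonFullLocus p (Spec (.of A))), isClosed_closure⟩ : Closeds (Spec (.of A))) = (affineBlowup.idealSheaf P).support := by
    apply Closeds.ext
    change closure _ = _
    rw [nonFullLocus_eq_support_of_locus p P hlocus]
    exact (Scheme.IdealSheafData.support _).isClosed.closure_eq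
  change Scheme.IdealSheafData.vanishingIdeal _ = _
  rw [hcl, Scheme.IdealSheafData.vanishingIdeal_support, IntrinsicTower.InstanceTauFloorP2d4C.radical_idealSheaf_of_isPrime]

/-- ★★ **THE LINK SHAPE**: ONE open immersion `j₀ : V ⟶ Bl_P (Spec A)` and the locus lemma make EVERY blowing up `π : B ⟶ Spec A` along the N-centre receive an open
immersion `V ⟶ B` (blowing ups along the same ideal sheaf are isomorphic over the base). This is the per-floor `hrec` datum of `TowerPersistenceKit.not_exists_tower_of_recurrent_family`.
[OURS · generic; cite: GortzWedhorn2020, Prop. 13.91 (2)] -/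
theorem exists_isOpenImmersion_of_isBlowup_nonFullCentre (p : ℕ) [Fact p.Prime] (k : Type) [Field k] [CharP k p] {A : Type} [CommRing A] [Algebra k A]
    (P : Ideal A) [P.IsPrime] (hlocus : ∀ w : Spec (.of A), ¬ FullCl p ((Spec (.of A)).presheaf.stalk w) ↔ P ≤ w.asIdeal)
    {V : Scheme.{0}} (j₀ : V ⟶ affineBlowup P) [IsOpenImmersion j₀]
    (B : Scheme.{0}) (π : B ⟶ Spec (.of A)) (hπ : IsBlowup π (nonFullCentre p (Spec (.of A)))) : ∃ j : V ⟶ B, IsOpenImmersion j := by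
  rw [nonFullCentre_eq_of_locus p k P hlocus] at hπ
  obtain ⟨e, -, -⟩ := (affineBlowup.isBlowup P).unique hπ
  exact ⟨j₀ ≫ e.hom, inferInstance⟩

/-- The v1 twin of the link: every blowing up along `IntrinsicTower.centre p (Spec A)` receives `V`. [OURS · generic] -/
theorem exists_isOpenImmersion_of_isBlowup_intrinsicCentre (p : ℕ) {A : Type} [CommRing A] (P : Ideal A) [P.IsPrime]
    (hlocus : ∀ w : Spec (.of A), ¬ FullCl p ((Spec (.of A)).presheaf.stalk w) ↔ P ≤ w.asIdeal)
    {V : Scheme.{0}} (j₀ : V ⟶ affineBlowup P) [IsOpenImmersion j₀]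
    (B : Scheme.{0}) (π : B ⟶ Spec (.of A)) (hπ : IsBlowup π (IntrinsicTower.centre p (Spec (.of A)))) : ∃ j : V ⟶ B, IsOpenImmersion j := by
  rw [intrinsicCentre_eq_of_locus p P hlocus] at hπ
  obtain ⟨e, -, -⟩ := (affineBlowup.isBlowup P).unique hπ
  exact ⟨j₀ ≫ e.hom, inferInstance⟩

/-- Non-FULL points go up along open immersions (isomorphic stalks): the `hbad` datum of any floor containing an open chart with a non-FULL point. [OURS · generic] -/
theorem exists_not_fullCl_of_isOpenImmersion (p : ℕ) {U F : Scheme.{0}} (jU : U ⟶ F) [IsOpenImmersion jU]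
    (hU : ∃ u : U, ¬ FullCl p (U.presheaf.stalk u)) : ∃ s : F, ¬ FullCl p (F.presheaf.stalk s) := by
  obtain ⟨u, hu⟩ := hU
  haveI : IsIso (jU.stalkMap u) := isIso_stalkMap_of_flat_of_isPreimmersion jU u
  exact ⟨jU.base u, fun h => hu (FullCentreDescent.fullCl_descends p jU u h)⟩

/-- ★★★ **THE GLOBAL STEP**: if `Spec A` (with its locus lemma and one chart `j₀ : V ⟶ Bl_P (Spec A)`) sits OPEN in a floor `F` (`jU`), then EVERY blowing up `π : F' ⟶ F`
of the WHOLE floor along ITS N-centre receives an open immersion `V ⟶ F'`: the N-centre is local along open immersions (`FullCentreDescent.nonFullCentreLiteral_local`, ✓ p635381), blowing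
ups restrict to opens by flat base change (Literature `IsBlowup.pullback_snd_of_flat`), and the link above applies to the restricted blow-up. This is the inductive step that
carries the chart path `U₁ ↪ F 0, U₂ ↪ F 1, …` up a GLOBAL N-tower (lead-1's NEG-A socket `hocc`). [OURS · generic; cite: GortzWedhorn2020, Prop. 13.91 (2)] -/
theorem exists_isOpenImmersion_of_isBlowup_of_isOpenImmersion (p : ℕ) [Fact p.Prime] (k : Type) [Field k] [CharP k p] {A : Type} [CommRing A] [Algebra k A]
    (P : Ideal A) [P.IsPrime] (hlocus : ∀ w : Spec (.of A), ¬ FullCl p ((Spec (.of A)).presheaf.stalk w) ↔ P ≤ w.asIdeal)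
    {V : Scheme.{0}} (j₀ : V ⟶ affineBlowup P) [IsOpenImmersion j₀]
    {F F' : Scheme.{0}} (jU : Spec (.of A) ⟶ F) [IsOpenImmersion jU] (π : F' ⟶ F) (hπ : IsBlowup π (nonFullCentre p F)) :
    ∃ j : V ⟶ F', IsOpenImmersion j := by
  have hsnd : IsBlowup (pullback.snd π jU) ((nonFullCentre p F).comap jU) := hπ.pullback_snd_of_flat jU
  have hloc : (nonFullCentre p F).comap jU = nonFullCentre p (Spec (.of A)) := FullCentreDescent.nonFullCentreLiteral_local p jU
  rw [hloc] at hsnd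
  obtain ⟨j, hj⟩ := exists_isOpenImmersion_of_isBlowup_nonFullCentre p k P hlocus j₀ _ _ hsnd
  exact ⟨j ≫ pullback.fst π jU, inferInstance⟩

end NonFullCentreOfLocus

/-! ## §2 Floor 1: every N-blow-up of `U₁` receives `U₂` -/

namespace NonFullLoopFloorOne

variable (k : Type) [Field k] [CharP k 2]

/-- The N-centre of floor 1 is the origin: `Recipes.nonFullCentre 2 U₁ = 𝔪~`. [OURS · unconditional] -/
theorem nonFullCentre_eq (g₁ : MvPolynomial (Fin 5) k) (hg₁ : g₁ = X 4 ^ 2 + X 0 ^ 5 * X 4 + X 0 * X 1 ^ 3 + X 0 * X 2 ^ 3 + X 0 * X 3 ^ 3) :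
    nonFullCentre 2 (Spec (.of (MvPolynomial (Fin 5) k ⧸ Ideal.span {g₁}))) =
      affineBlowup.idealSheaf (Ideal.span (Set.range fun j : Fin 5 => Ideal.Quotient.mk (Ideal.span {g₁}) (X j))) := by
  haveI : Fact (Nat.Prime 2) := ⟨Nat.prime_two⟩
  haveI := (isMaximal_origin k g₁ hg₁).isPrime
  exact NonFullCentreOfLocus.nonFullCentre_eq_of_locus 2 k _ (not_fullCl_stalk_iff_origin_le k g₁ hg₁)

/-- A non-FULL point of `U₁` (its origin): the `hbad` datum of floor 1. [OURS · unconditional] -/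
theorem exists_not_fullCl (g₁ : MvPolynomial (Fin 5) k) (hg₁ : g₁ = X 4 ^ 2 + X 0 ^ 5 * X 4 + X 0 * X 1 ^ 3 + X 0 * X 2 ^ 3 + X 0 * X 3 ^ 3) :
    ∃ u : Spec (.of (MvPolynomial (Fin 5) k ⧸ Ideal.span {g₁})), ¬ FullCl 2 ((Spec (.of (MvPolynomial (Fin 5) k ⧸ Ideal.span {g₁}))).presheaf.stalk u) :=
  haveI := (isMaximal_origin k g₁ hg₁).isPrime
  ⟨⟨Ideal.span (Set.range fun j : Fin 5 => Ideal.Quotient.mk (Ideal.span {g₁}) (X j)), inferInstance⟩, not_fullCl_of_origin_le k g₁ hg₁ _ le_rfl⟩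

/-- ★★ **THE FLOOR-1 LINK**: EVERY blowing up of `U₁ = Spec k[X]/(g₁)` along its N-centre receives `U₂ = Spec k[X]/(g₂)` as an open subscheme (`char k = 2`).
[OURS · unconditional; cite: GortzWedhorn2020, Prop. 13.91 (2)] -/
theorem exists_isOpenImmersion_of_isBlowup (g₁ : MvPolynomial (Fin 5) k) (hg₁ : g₁ = X 4 ^ 2 + X 0 ^ 5 * X 4 + X 0 * X 1 ^ 3 + X 0 * X 2 ^ 3 + X 0 * X 3 ^ 3)
    (g₂ : MvPolynomial (Fin 5) k) (hg₂ : g₂ = X 4 ^ 2 + X 0 ^ 4 * X 4 + X 0 ^ 2 * X 1 ^ 3 + X 0 ^ 2 * X 2 ^ 3 + X 0 ^ 2 * X 3 ^ 3)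
    (B : Scheme.{0}) (π : B ⟶ Spec (.of (MvPolynomial (Fin 5) k ⧸ Ideal.span {g₁})))
    (hπ : IsBlowup π (nonFullCentre 2 (Spec (.of (MvPolynomial (Fin 5) k ⧸ Ideal.span {g₁}))))) :
    ∃ j : Spec (.of (MvPolynomial (Fin 5) k ⧸ Ideal.span {g₂})) ⟶ B, IsOpenImmersion j := by
  haveI : Fact (Nat.Prime 2) := ⟨Nat.prime_two⟩
  haveI := (isMaximal_origin k g₁ hg₁).isPrime
  obtain ⟨j₀, hj₀⟩ := exists_chart_isOpenImmersion k g₁ hg₁ g₂ hg₂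
  exact NonFullCentreOfLocus.exists_isOpenImmersion_of_isBlowup_nonFullCentre 2 k _ (not_fullCl_stalk_iff_origin_le k g₁ hg₁) j₀ B π hπ

/-- ★★★ **THE FLOOR-1 GLOBAL STEP**: if `U₁` is open in a floor `F`, every blowing up of `F` along its N-centre contains `U₂` as an open. [OURS · unconditional] -/
theorem exists_isOpenImmersion_step (g₁ : MvPolynomial (Fin 5) k) (hg₁ : g₁ = X 4 ^ 2 + X 0 ^ 5 * X 4 + X 0 * X 1 ^ 3 + X 0 * X 2 ^ 3 + X 0 * X 3 ^ 3)
    (g₂ : MvPolynomial (Fin 5) k) (hg₂ : g₂ = X 4 ^ 2 + X 0 ^ 4 * X 4 + X 0 ^ 2 * X 1 ^ 3 + X 0 ^ 2 * X 2 ^ 3 + X 0 ^ 2 * X 3 ^ 3)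
    {F F' : Scheme.{0}} (jU : Spec (.of (MvPolynomial (Fin 5) k ⧸ Ideal.span {g₁})) ⟶ F) [IsOpenImmersion jU] (π : F' ⟶ F) (hπ : IsBlowup π (nonFullCentre 2 F)) :
    ∃ j : Spec (.of (MvPolynomial (Fin 5) k ⧸ Ideal.span {g₂})) ⟶ F', IsOpenImmersion j := by
  haveI : Fact (Nat.Prime 2) := ⟨Nat.prime_two⟩
  haveI := (isMaximal_origin k g₁ hg₁).isPrime
  obtain ⟨j₀, hj₀⟩ := exists_chart_isOpenImmersion k g₁ hg₁ g₂ hg₂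
  exact NonFullCentreOfLocus.exists_isOpenImmersion_of_isBlowup_of_isOpenImmersion 2 k _ (not_fullCl_stalk_iff_origin_le k g₁ hg₁) j₀ jU π hπ

end NonFullLoopFloorOne

/-! ## §3 Floor 3: every N-blow-up of `U₃` receives `U₄` -/

namespace NonFullLoopFloorThree

variable (k : Type) [Field k] [CharP k 2]

/-- The N-centre of floor 3 is the origin: `Recipes.nonFullCentre 2 U₃ = 𝔪~`. [OURS · unconditional] -/
theorem nonFullCentre_eq (g₃ : MvPolynomial (Fin 5) k) (hg₃ : g₃ = X 4 ^ 2 + X 0 ^ 3 * X 4 + X 1 ^ 3 + X 2 ^ 3 + X 3 ^ 3) :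
    nonFullCentre 2 (Spec (.of (MvPolynomial (Fin 5) k ⧸ Ideal.span {g₃}))) =
      affineBlowup.idealSheaf (Ideal.span (Set.range fun j : Fin 5 => Ideal.Quotient.mk (Ideal.span {g₃}) (X j))) := by
  haveI : Fact (Nat.Prime 2) := ⟨Nat.prime_two⟩
  haveI := (isMaximal_origin k g₃ hg₃).isPrime
  exact NonFullCentreOfLocus.nonFullCentre_eq_of_locus 2 k _ (not_fullCl_stalk_iff_origin_le k g₃ hg₃)

/-- A non-FULL point of `U₃` (its origin): the `hbad` datum of floor 3. [OURS · unconditional] -/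
theorem exists_not_fullCl (g₃ : MvPolynomial (Fin 5) k) (hg₃ : g₃ = X 4 ^ 2 + X 0 ^ 3 * X 4 + X 1 ^ 3 + X 2 ^ 3 + X 3 ^ 3) :
    ∃ u : Spec (.of (MvPolynomial (Fin 5) k ⧸ Ideal.span {g₃})), ¬ FullCl 2 ((Spec (.of (MvPolynomial (Fin 5) k ⧸ Ideal.span {g₃}))).presheaf.stalk u) :=
  haveI := (isMaximal_origin k g₃ hg₃).isPrime
  ⟨⟨Ideal.span (Set.range fun j : Fin 5 => Ideal.Quotient.mk (Ideal.span {g₃}) (X j)), inferInstance⟩, not_fullCl_of_origin_le k g₃ hg₃ _ le_rfl⟩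

/-- ★★ **THE FLOOR-3 LINK**: EVERY blowing up of `U₃ = Spec k[X]/(g₃)` along its N-centre receives `U₄ = Spec k[X]/(g₄)` as an open subscheme (`char k = 2`).
[OURS · unconditional; cite: GortzWedhorn2020, Prop. 13.91 (2)] -/
theorem exists_isOpenImmersion_of_isBlowup (g₃ : MvPolynomial (Fin 5) k) (hg₃ : g₃ = X 4 ^ 2 + X 0 ^ 3 * X 4 + X 1 ^ 3 + X 2 ^ 3 + X 3 ^ 3)
    (g₄ : MvPolynomial (Fin 5) k) (hg₄ : g₄ = X 4 ^ 2 + X 0 ^ 2 * X 4 + X 0 * X 1 ^ 3 + X 0 * X 2 ^ 3 + X 0 * X 3 ^ 3)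
    (B : Scheme.{0}) (π : B ⟶ Spec (.of (MvPolynomial (Fin 5) k ⧸ Ideal.span {g₃})))
    (hπ : IsBlowup π (nonFullCentre 2 (Spec (.of (MvPolynomial (Fin 5) k ⧸ Ideal.span {g₃}))))) :
    ∃ j : Spec (.of (MvPolynomial (Fin 5) k ⧸ Ideal.span {g₄})) ⟶ B, IsOpenImmersion j := by
  haveI : Fact (Nat.Prime 2) := ⟨Nat.prime_two⟩
  haveI := (isMaximal_origin k g₃ hg₃).isPrime
  obtain ⟨j₀, hj₀⟩ := exists_chart_isOpenImmersion k g₃ hg₃ g₄ hg₄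
  exact NonFullCentreOfLocus.exists_isOpenImmersion_of_isBlowup_nonFullCentre 2 k _ (not_fullCl_stalk_iff_origin_le k g₃ hg₃) j₀ B π hπ

/-- ★★★ **THE FLOOR-3 GLOBAL STEP**: if `U₃` is open in a floor `F`, every blowing up of `F` along its N-centre contains `U₄` as an open. [OURS · unconditional] -/
theorem exists_isOpenImmersion_step (g₃ : MvPolynomial (Fin 5) k) (hg₃ : g₃ = X 4 ^ 2 + X 0 ^ 3 * X 4 + X 1 ^ 3 + X 2 ^ 3 + X 3 ^ 3)
    (g₄ : MvPolynomial (Fin 5) k) (hg₄ : g₄ = X 4 ^ 2 + X 0 ^ 2 * X 4 + X 0 * X 1 ^ 3 + X 0 * X 2 ^ 3 + X 0 * X 3 ^ 3)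
    {F F' : Scheme.{0}} (jU : Spec (.of (MvPolynomial (Fin 5) k ⧸ Ideal.span {g₃})) ⟶ F) [IsOpenImmersion jU] (π : F' ⟶ F) (hπ : IsBlowup π (nonFullCentre 2 F)) :
    ∃ j : Spec (.of (MvPolynomial (Fin 5) k ⧸ Ideal.span {g₄})) ⟶ F', IsOpenImmersion j := by
  haveI : Fact (Nat.Prime 2) := ⟨Nat.prime_two⟩
  haveI := (isMaximal_origin k g₃ hg₃).isPrime
  obtain ⟨j₀, hj₀⟩ := exists_chart_isOpenImmersion k g₃ hg₃ g₄ hg₄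
  exact NonFullCentreOfLocus.exists_isOpenImmersion_of_isBlowup_of_isOpenImmersion 2 k _ (not_fullCl_stalk_iff_origin_le k g₃ hg₃) j₀ jU π hπ

end NonFullLoopFloorThree

/-! ## §4 Floor 5 (the period-one germ `U₀`): every N-blow-up of `U₀` receives `U₀` itself -/

namespace NonFullLoopFloorFive

variable (k : Type) [Field k] [CharP k 2]

/-- A non-FULL point of `U₀` (the generic point of `V(x̄,ȳ,z̄)`): the `hbad` datum of floor 5, hypothesis-free. [OURS · unconditional] -/
theorem exists_not_fullCl (g : MvPolynomial (Fin 5) k)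
    (hg : g = X 4 ^ 2 + X 0 ^ 2 * X 1 * X 4 + X 0 * X 1 ^ 2 * X 2 ^ 3 + X 0 * X 1 ^ 2 * X 3 ^ 3 + X 0 * X 1 ^ 2) :
    ∃ u : Spec (.of (MvPolynomial (Fin 5) k ⧸ Ideal.span {g})), ¬ FullCl 2 ((Spec (.of (MvPolynomial (Fin 5) k ⧸ Ideal.span {g}))).presheaf.stalk u) :=
  NonFullLoopFrame.exists_not_fullCl k g hg (not_fullCl_stalk_iff_centre_le k g hg)

/-- ★★ **THE FLOOR-5 LINK = THE LOOP**: EVERY blowing up of the period-one germ `U₀ = Spec k[X]/(g₅)` along its N-centre `(x̄,ȳ,z̄)~` receives `U₀` ITSELF as an open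
subscheme (`char k = 2`; lead-1's chart open immersion `NonFullLoopFrame.exists_chart_isOpenImmersion` + the discharged centre identification). [OURS · unconditional;
cite: GortzWedhorn2020, Prop. 13.91 (2)] -/
theorem exists_isOpenImmersion_of_isBlowup (g : MvPolynomial (Fin 5) k)
    (hg : g = X 4 ^ 2 + X 0 ^ 2 * X 1 * X 4 + X 0 * X 1 ^ 2 * X 2 ^ 3 + X 0 * X 1 ^ 2 * X 3 ^ 3 + X 0 * X 1 ^ 2)
    (B : Scheme.{0}) (π : B ⟶ Spec (.of (MvPolynomial (Fin 5) k ⧸ Ideal.span {g})))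
    (hπ : IsBlowup π (nonFullCentre 2 (Spec (.of (MvPolynomial (Fin 5) k ⧸ Ideal.span {g}))))) :
    ∃ j : Spec (.of (MvPolynomial (Fin 5) k ⧸ Ideal.span {g})) ⟶ B, IsOpenImmersion j := by
  haveI : Fact (Nat.Prime 2) := ⟨Nat.prime_two⟩
  haveI := NonFullLoopFrame.isPrime_centre k g hg
  obtain ⟨j₀, hj₀⟩ := NonFullLoopFrame.exists_chart_isOpenImmersion k g hg
  exact NonFullCentreOfLocus.exists_isOpenImmersion_of_isBlowup_nonFullCentre 2 k _ (not_fullCl_stalk_iff_centre_le k g hg) j₀ B π hπ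

/-- ★★★ **THE FLOOR-5 GLOBAL STEP = THE LOOP CLOSES IN ANY TOWER**: if the period-one germ `U₀` is open in a floor `F`, every blowing up of `F` along its N-centre contains `U₀`
again as an open. [OURS · unconditional] -/
theorem exists_isOpenImmersion_step (g : MvPolynomial (Fin 5) k)
    (hg : g = X 4 ^ 2 + X 0 ^ 2 * X 1 * X 4 + X 0 * X 1 ^ 2 * X 2 ^ 3 + X 0 * X 1 ^ 2 * X 3 ^ 3 + X 0 * X 1 ^ 2)
    {F F' : Scheme.{0}} (jU : Spec (.of (MvPolynomial (Fin 5) k ⧸ Ideal.span {g})) ⟶ F) [IsOpenImmersion jU] (π : F' ⟶ F) (hπ : IsBlowup π (nonFullCentre 2 F)) :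
    ∃ j : Spec (.of (MvPolynomial (Fin 5) k ⧸ Ideal.span {g})) ⟶ F', IsOpenImmersion j := by
  haveI : Fact (Nat.Prime 2) := ⟨Nat.prime_two⟩
  haveI := NonFullLoopFrame.isPrime_centre k g hg
  obtain ⟨j₀, hj₀⟩ := NonFullLoopFrame.exists_chart_isOpenImmersion k g hg
  exact NonFullCentreOfLocus.exists_isOpenImmersion_of_isBlowup_of_isOpenImmersion 2 k _ (not_fullCl_stalk_iff_centre_le k g hg) j₀ jU π hπ

end NonFullLoopFloorFive

end Summit.ResolutionOfSingularities.ResolutionOfSingularities.Theorems.FInjectiveMacaulayfication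

end
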